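import Summits.HodgeConjecture.HodgeConjecture.Theorems.F0P2gStubNSIOfCore
import Literature.NumberTheory.Automorphic.UnitaryGroupOddLineNoIntegralEigenvector
import HarnessLib

/-!
# FLOOR-0 P2 — ROAD δ corollary: «the non-trivial class is not spherical, a.e.» for EVERY family of local splittings and EVERY
# character of the centre (crux item stmt-HodgeConjecture-24833 `HCCMUnconditional.H413`; NSI ★ `F0P2gStubNSINontrivialClassNotSpherical`)

Cell hodgecm-mathlib (D-0151), FLOOR 0, programme P2; seat B-p18 (g24) (self-placed small row, P2 bus 2026-08-31T07:07Z).  THEOREMS ONLY (no `def`,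
no instance, no notation, no named fact, no `sorry`); imports no `Cruxes/…/Lines` module.

In ★ `F0P2gStubNSIOfCore.stubNSI_of_core` (NSI modulo (CORE′)) the splitting family `chiLocalSplittingsD … ε` and the centre character
`localCharOfCenter … χ.1 v` enter ONLY as the arguments `𝓢`, `χ₁` of the generic lemmas ★ `F0P2gStubNSILocalLemmas.exists_ne_zero_fixed_of_isSpherical_coinv`
∕ `forall_implementer_eigen_of_fixed`, and (CORE′) ★ `UnitaryGroup.eq_zero_of_forall_implementer_eigen_of_odd` (p813770, the integral uncertainty
principle of `UnitaryGroupOddLineNoIntegralEigenvector`) is SPLITTING-FREE.  Hence, UNCONDITIONALLY and for EVERY restricted family of local splittings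
`𝓢` of `U(diag dV ⊗ (ε))` over `ι_v` and EVERY character `χ₁` of the centre `U((ε))(L⁺_v) = L_v¹`:

* `locF_eq_one_of_isSpherical_rep_of_smul_eq` — at a place `v` of `L⁺` unramified in `L`, NON-SPLIT, with `2`, `δ²`, all `dV i` units and `ψ_v` of
  conductor `𝒪_v`: if the `χ₁`-coinvariant quotient of `ω_{𝓢,v}` restricted along `k ↦ k ⊗ 1` has a `U(diag dV)(𝒪_v)`-spherical line then `[ε]_v = 1`;
* **`eventually_locF_eq_one_of_isSpherical_rep`** — at all but finitely many `v` (a cofinite set INDEPENDENT of `ε`, `𝓢`, `χ₁`), for every `ε`, `𝓢`, `χ₁`: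
  spherical ⇒ `[ε]_v = 1` (split places by ★ `isSquare_of_smul_ne`).

So Liu's local theta type `X_v(μ, ε, χ)` has no hyperspecial line at a.e. `v` with `[ε]_v ≠ 1` for ANY normalisation of the oscillator splitting
(`muLocalSplittings`, `chiLocalSplittingsD`, GR's `splittingOf`, …) — the form a re-normalised consumer (E3♭'s DICTn, P3b's 13.1.3 (d) row) cites without
re-running road δ.  `--supports stmt-HodgeConjecture-24833 --as helper`.  HONEST LABEL: nothing printed is discharged; HC_CM is proved only modulo the
printed citations until rung 0 closes.

## References
* [GelbartRogawski1991] S. Gelbart, J. Rogawski, Invent. Math. 105 (1991): Lem. 5.1.2 p. 466, p. 467 L25–27; §3.1 Prop. 3.1.1 p. 455, Remark p. 457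
  (two splittings differ by a character).
* [HarrisKudlaSweet1996] M. Harris, S. Kudla, W. Sweet, J. AMS 9 (1996): Thm. 6.1, §1 (1.14)–(1.15).
* [Omeara1963] O. T. O'Meara, *Introduction to Quadratic Forms* (1963): §63C Example 63:16.
-/

set_option autoImplicit false
-- the mandated namespace has the single-problem summit's repeated segment (`HodgeConjecture.HodgeConjecture`)
set_option linter.dupNamespace false

noncomputable section

open NumberField MeasureTheory IsDedekindDomain Set
open scoped Matrix Kronecker ComplexOrder NNReal

namespace Summit.HodgeConjecture.HodgeConjecture.Cruxes.H413.F0P2gNSIAnySplitting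

open Literature.NumberTheory Literature.NumberTheory.Automorphic Literature.NumberTheory.Automorphic.UnitaryGroup
open Literature.NumberTheory.Automorphic.Liu2021 Literature.NumberTheory.Automorphic.Liu2021.Def411WeilCarriers
open Literature.NumberTheory.GelbartRogawski1991 Literature.NumberTheory.GelbartRogawski1991.UnitaryDualPair
open Literature.NumberTheory.GelbartRogawski1991.UnitaryDualPair.WeilCoinv
open Literature.NumberTheory.GelbartRogawski1991.UnitaryDualPair.LocalSplitting
open Literature.NumberTheory.QuadraticForms
open Literature.NumberTheory.GaloisRepresentations.IsNonarchimedeanLocalField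
open Literature.RepresentationTheory Literature.RepresentationTheory.HeisenbergGroup
open Summit.HodgeConjecture.HodgeConjecture.Cruxes.H413.F0P2gStubNSILocalLemmas
open Summit.HodgeConjecture.HodgeConjecture.Cruxes.H413.F0P2gStubNSIOfCore

variable (L : Type) [Field L] [NumberField L] [IsCMField L]

/-- **the inert place step, for ANY splitting family `𝓢` and ANY centre character `χ₁` (unconditional)**: at a place `v` of `L⁺` unramified in `L`,
non-split (`c • w = w` for a place `w ∣ v`), with `2`, `δ²` and all `dV i` units and `ψ_v` of conductor `𝒪_v`: a `U(diag dV)(𝒪_v)`-spherical line of the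
`χ₁`-coinvariant quotient of `ω_{𝓢,v}` (restricted along `k ↦ k ⊗ 1`) forces `[ε]_v = 1`.  (§2 of ★ `F0P2gStubNSILocalLemmas` lifts the line to a non-zero
Schwartz–Bruhat function fixed by the integral `ω_{𝓢,v}(u ⊗ 1)`, hence an eigenvector of every implementer of the integral `ι_v(k)`; were `[ε]_v ≠ 1`,
`ord_v ε` would be odd and (CORE′) ★ `UnitaryGroup.eq_zero_of_forall_implementer_eigen_of_odd` kills it.)
[cite: GelbartRogawski1991, Lem 5.1.2 p. 466, p. 467] [cite: HarrisKudlaSweet1996, Thm 6.1] [cite: Omeara1963, §63C Example 63:16] -/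
theorem locF_eq_one_of_isSpherical_rep_of_smul_eq {n' : ℕ} (e₁ : Fin 3 × Fin 1 ≃ Fin n') (dV : Fin 3 → L)
    (hdV : ∀ i, IsCMField.complexConj L (dV i) = dV i) (hdV0 : ∀ i, dV i ≠ 0) (ε : (↥(maximalRealSubfield L))ˣ)
    (𝓢 : FinLocalSplittings (↥(maximalRealSubfield L)) L (IsCMField.complexConj L) n' (complexConj_imagUnit L) (imagUnit_ne_zero L) (imagUnit_mul_self L)
      (gram (↥(maximalRealSubfield L)) e₁ (realDiagonal L dV hdV) (TW (↥(maximalRealSubfield L)) ε))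
      (isSymm_gram (↥(maximalRealSubfield L)) e₁ (realDiagonal_isSymm L dV hdV) (isSymm_TW (↥(maximalRealSubfield L)) ε))
      (J := Matrix.reindex e₁ e₁ (Matrix.diagonal dV ⊗ₖ JW (↥(maximalRealSubfield L)) L ε))
      (reindex_kronecker_eq_gram_map (↥(maximalRealSubfield L)) L e₁ (realDiagonal_map L dV hdV).symm (JW_eq (↥(maximalRealSubfield L)) L ε)))
    (v : HeightOneSpectrum (𝓞 ↥(maximalRealSubfield L)))
    (hunr : Algebra.IsUnramifiedIn (𝓞 L) v.asIdeal) (h2v : Valued.v (2 : v.adicCompletion ↥(maximalRealSubfield L)) = 1)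
    (hdv : Valued.v (algebraMap (↥(maximalRealSubfield L)) (v.adicCompletion ↥(maximalRealSubfield L)) (imagUnitSq L)) = 1)
    (hψ : (adeleAddCharAt (↥(maximalRealSubfield L)) v).HasConductorExp 0)
    (hdVv : ∀ i, Valued.v (algebraMap (↥(maximalRealSubfield L)) (v.adicCompletion ↥(maximalRealSubfield L))
      (⟨dV i, (IsCMField.complexConj_eq_self_iff (K := L) (dV i)).1 (hdV i)⟩ : ↥(maximalRealSubfield L))) = 1)
    (w : PlacesOver L v) (hw : IsCMField.complexConj L • w.1 = w.1) (χ₁ : localPi L (IsCMField.complexConj L) 1 (JW (↥(maximalRealSubfield L)) L ε) v →* ℂˣ)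
    (hsph : Representation.IsSpherical
      ((show Representation ℂ (localPi L (IsCMField.complexConj L) 3 (Matrix.diagonal dV) v) _ from
        (TwistedCoinv.rep χ₁ (𝓢.omegaLoc v)
          (commute_omegaLoc_localCenter (↥(maximalRealSubfield L)) L (IsCMField.complexConj L) 3 e₁ (Matrix.diagonal dV)
            (JW (↥(maximalRealSubfield L)) L ε) (complexConj_imagUnit L) (imagUnit_ne_zero L) (imagUnit_mul_self L)
            (realDiagonal_isSymm L dV hdV) (isSymm_TW (↥(maximalRealSubfield L)) ε) (realDiagonal_map L dV hdV).symm
            (JW_eq (↥(maximalRealSubfield L)) L ε) (JW_apply_ne_zero (↥(maximalRealSubfield L)) L ε) 𝓢 v)).comp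
          (UnitaryGroup.localLineInl L (IsCMField.complexConj L) 3 e₁ (Matrix.diagonal dV) (JW (↥(maximalRealSubfield L)) L ε) v)))
      (localInt L (IsCMField.complexConj L) 3 (Matrix.diagonal dV) v)) :
    locF (↥(maximalRealSubfield L)) (imagUnitSq L) ε v = 1 := by
  have hc1 : IsCMField.complexConj L ≠ 1 := IsCMField.complexConj_ne_one L
  have hE : IsField (UnitaryGroup.LocalRing L v) := LocalRing.isField_of_smul_eq (IsCMField.complexConj L) hc1 w hw
  have hcoe : ((imagUnitSq L : ↥(maximalRealSubfield L)) : v.adicCompletion ↥(maximalRealSubfield L)) = algebraMap (↥(maximalRealSubfield L)) (v.adicCompletion ↥(maximalRealSubfield L)) (imagUnitSq L) := rfl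
  have hnsq : ¬ IsSquare (algebraMap (↥(maximalRealSubfield L)) (v.adicCompletion ↥(maximalRealSubfield L)) (imagUnitSq L)) := by
    rintro ⟨r, hr⟩
    rw [← hcoe] at hr
    exact mul_self_ne_d_of_isField L (IsCMField.complexConj L) (complexConj_imagUnit L) (imagUnit_ne_zero L)
      (imagUnit_mul_self L) v hE r hr.symm
  by_contra hne
  have hodd := odd_log_valued_of_locF_ne_one L hunr hnsq hne
  obtain ⟨f, hf0, hf⟩ := exists_ne_zero_fixed_of_isSpherical_coinv (↥(maximalRealSubfield L)) L (IsCMField.complexConj L) 3 e₁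
    (Matrix.diagonal dV) (JW (↥(maximalRealSubfield L)) L ε) (complexConj_imagUnit L) (imagUnit_ne_zero L) (imagUnit_mul_self L)
    (realDiagonal_isSymm L dV hdV) (isSymm_TW (↥(maximalRealSubfield L)) ε) (realDiagonal_map L dV hdV).symm
    (JW_eq (↥(maximalRealSubfield L)) L ε) (JW_apply_ne_zero (↥(maximalRealSubfield L)) L ε) 𝓢 v χ₁ hsph
  have heig := forall_implementer_eigen_of_fixed (↥(maximalRealSubfield L)) L (IsCMField.complexConj L) 3 e₁ (Matrix.diagonal dV)
    (JW (↥(maximalRealSubfield L)) L ε) (complexConj_imagUnit L) (imagUnit_ne_zero L) (imagUnit_mul_self L)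
    (realDiagonal_isSymm L dV hdV) (isSymm_TW (↥(maximalRealSubfield L)) ε) (realDiagonal_map L dV hdV).symm
    (JW_eq (↥(maximalRealSubfield L)) L ε) (JW_apply_ne_zero (↥(maximalRealSubfield L)) L ε) 𝓢
    (isUnit_det_realDiagonal L dV hdV hdV0) (isUnit_det_TW (↥(maximalRealSubfield L)) ε) v f hf
  have h2' : normAbs (v.adicCompletion ↥(maximalRealSubfield L)) (2 : v.adicCompletion ↥(maximalRealSubfield L)) = 1 := by
    rw [normAbs_eq_inv_zpow_of_valued_eq v (n := 0) (by rw [h2v, WithZero.exp_zero]), neg_zero, zpow_zero]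
  have hdv' : normAbs (v.adicCompletion ↥(maximalRealSubfield L)) (algebraMap (↥(maximalRealSubfield L)) (v.adicCompletion ↥(maximalRealSubfield L)) (imagUnitSq L)) = 1 := by
    rw [normAbs_eq_inv_zpow_of_valued_eq v (n := 0) (by rw [hdv, WithZero.exp_zero]), neg_zero, zpow_zero]
  have hε0 : Valued.v (algebraMap (↥(maximalRealSubfield L)) (v.adicCompletion ↥(maximalRealSubfield L)) (ε : ↥(maximalRealSubfield L))) ≠ 0 :=
    (Valuation.ne_zero_iff _).2 ((map_ne_zero _).2 ε.ne_zero)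
  have hm : ∀ i : Fin n', normAbs (v.adicCompletion ↥(maximalRealSubfield L)) (algebraMap (↥(maximalRealSubfield L)) (v.adicCompletion ↥(maximalRealSubfield L))
      ((⟨dV (e₁.symm i).1, (IsCMField.complexConj_eq_self_iff (K := L) _).1 (hdV _)⟩ : ↥(maximalRealSubfield L)) * (ε : ↥(maximalRealSubfield L)))) =
        ((residueFieldCard (v.adicCompletion ↥(maximalRealSubfield L)) : ℝ≥0)⁻¹) ^
          (-WithZero.log (Valued.v (algebraMap (↥(maximalRealSubfield L)) (v.adicCompletion ↥(maximalRealSubfield L)) (ε : ↥(maximalRealSubfield L))))) := fun i =>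
    normAbs_eq_inv_zpow_of_valued_eq v (by rw [map_mul, map_mul, hdVv, one_mul, WithZero.exp_log hε0])
  exact hf0 (UnitaryGroup.eq_zero_of_forall_implementer_eigen_of_odd L (IsCMField.complexConj L) n'
    (Matrix.reindex e₁ e₁ (Matrix.diagonal dV ⊗ₖ JW (↥(maximalRealSubfield L)) L ε)) v (complexConj_imagUnit L) (imagUnit_ne_zero L) (imagUnit_mul_self L)
    (gram (↥(maximalRealSubfield L)) e₁ (realDiagonal L dV hdV) (TW (↥(maximalRealSubfield L)) ε))
    (isSymm_gram (↥(maximalRealSubfield L)) e₁ (realDiagonal_isSymm L dV hdV) (isSymm_TW (↥(maximalRealSubfield L)) ε))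
    (reindex_kronecker_eq_gram_map (↥(maximalRealSubfield L)) L e₁ (realDiagonal_map L dV hdV).symm (JW_eq (↥(maximalRealSubfield L)) L ε))
    _ (gram_realDiagonal_TW_eq_diagonal L e₁ dV hdV ε) (e₁ (0, 0)) (e₁ (1, 0)) (equiv_apply_ne e₁) hE h2' hdv' hψ
    _ hm hodd.neg f heig)

/-- **«the non-trivial class is not spherical, a.e.» for EVERY splitting family and EVERY centre character (unconditional).**  At all but finitely many finite
places `v` of `L⁺` — a cofinite set depending only on `L` and `dV` (places unramified in `L`, prime to `2`, `δ²` and the `dV i` units, `ψ_v` of conductor `𝒪_v`),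
NOT on `ε`, `𝓢` or `χ₁` — for every `ε ∈ (L⁺)ˣ`, every restricted family `𝓢` of local splittings of `U(diag dV ⊗ (ε))` over `ι_v` and every character `χ₁` of the
centre: if the `χ₁`-coinvariant quotient of `ω_{𝓢,v}` restricted along `k ↦ k ⊗ 1` has a `U(diag dV)(𝒪_v)`-spherical line, then `[ε]_v = 1`.  (Split `v`: every class is
trivial, ★ `isSquare_of_smul_ne`; inert `v`: `locF_eq_one_of_isSpherical_rep_of_smul_eq`.)
[cite: GelbartRogawski1991, Lem 5.1.2 p. 466, p. 467; §3.1 Remark p. 457] [cite: HarrisKudlaSweet1996, Thm 6.1] [cite: Omeara1963, §63C Example 63:16] -/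
theorem eventually_locF_eq_one_of_isSpherical_rep {n' : ℕ} (e₁ : Fin 3 × Fin 1 ≃ Fin n') (dV : Fin 3 → L)
    (hdV : ∀ i, IsCMField.complexConj L (dV i) = dV i) (hdV0 : ∀ i, dV i ≠ 0) :
    ∀ᶠ v in Filter.cofinite, ∀ (ε : (↥(maximalRealSubfield L))ˣ)
      (𝓢 : FinLocalSplittings (↥(maximalRealSubfield L)) L (IsCMField.complexConj L) n' (complexConj_imagUnit L) (imagUnit_ne_zero L) (imagUnit_mul_self L)
        (gram (↥(maximalRealSubfield L)) e₁ (realDiagonal L dV hdV) (TW (↥(maximalRealSubfield L)) ε))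
        (isSymm_gram (↥(maximalRealSubfield L)) e₁ (realDiagonal_isSymm L dV hdV) (isSymm_TW (↥(maximalRealSubfield L)) ε))
        (J := Matrix.reindex e₁ e₁ (Matrix.diagonal dV ⊗ₖ JW (↥(maximalRealSubfield L)) L ε))
        (reindex_kronecker_eq_gram_map (↥(maximalRealSubfield L)) L e₁ (realDiagonal_map L dV hdV).symm (JW_eq (↥(maximalRealSubfield L)) L ε)))
      (χ₁ : localPi L (IsCMField.complexConj L) 1 (JW (↥(maximalRealSubfield L)) L ε) v →* ℂˣ),
      Representation.IsSpherical
        ((show Representation ℂ (localPi L (IsCMField.complexConj L) 3 (Matrix.diagonal dV) v) _ from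
          (TwistedCoinv.rep χ₁ (𝓢.omegaLoc v)
            (commute_omegaLoc_localCenter (↥(maximalRealSubfield L)) L (IsCMField.complexConj L) 3 e₁ (Matrix.diagonal dV)
              (JW (↥(maximalRealSubfield L)) L ε) (complexConj_imagUnit L) (imagUnit_ne_zero L) (imagUnit_mul_self L)
              (realDiagonal_isSymm L dV hdV) (isSymm_TW (↥(maximalRealSubfield L)) ε) (realDiagonal_map L dV hdV).symm
              (JW_eq (↥(maximalRealSubfield L)) L ε) (JW_apply_ne_zero (↥(maximalRealSubfield L)) L ε) 𝓢 v)).comp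
            (UnitaryGroup.localLineInl L (IsCMField.complexConj L) 3 e₁ (Matrix.diagonal dV) (JW (↥(maximalRealSubfield L)) L ε) v)))
        (localInt L (IsCMField.complexConj L) 3 (Matrix.diagonal dV) v) →
      locF (↥(maximalRealSubfield L)) (imagUnitSq L) ε v = 1 := by
  have hd0 : imagUnitSq L ≠ 0 := fun h => imagUnit_ne_zero L (by
    have := imagUnit_mul_self L; rw [h, map_zero, mul_self_eq_zero] at this; exact this)
  have hdV' : ∀ i, (⟨dV i, (IsCMField.complexConj_eq_self_iff (K := L) (dV i)).1 (hdV i)⟩ : ↥(maximalRealSubfield L)) ≠ 0 :=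
    fun i h => hdV0 i (congrArg Subtype.val h)
  have h_unr : ∀ᶠ v : HeightOneSpectrum (𝓞 ↥(maximalRealSubfield L)) in Filter.cofinite, Algebra.IsUnramifiedIn (𝓞 L) v.asIdeal :=
    Filter.eventually_cofinite.2 (GaloisRepresentations.finite_setOf_not_isUnramifiedIn (↥(maximalRealSubfield L)) L)
  have h_twov : ∀ᶠ v : HeightOneSpectrum (𝓞 ↥(maximalRealSubfield L)) in Filter.cofinite, Valued.v (2 : v.adicCompletion ↥(maximalRealSubfield L)) = 1 :=
    (eventually_valued_algebraMap_eq_one (↥(maximalRealSubfield L)) (two_ne_zero : (2 : ↥(maximalRealSubfield L)) ≠ 0)).mono fun v hv => by rwa [map_ofNat] at hv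
  have h_d : ∀ᶠ v : HeightOneSpectrum (𝓞 ↥(maximalRealSubfield L)) in Filter.cofinite,
      Valued.v (algebraMap (↥(maximalRealSubfield L)) (v.adicCompletion ↥(maximalRealSubfield L)) (imagUnitSq L)) = 1 :=
    eventually_valued_algebraMap_eq_one (↥(maximalRealSubfield L)) hd0
  have h_psi : ∀ᶠ v : HeightOneSpectrum (𝓞 ↥(maximalRealSubfield L)) in Filter.cofinite, (adeleAddCharAt (↥(maximalRealSubfield L)) v).HasConductorExp 0 :=
    eventually_hasConductorExp_zero_adicComponent_adeleAddChar (K := ↥(maximalRealSubfield L))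
  have h_dV : ∀ᶠ v : HeightOneSpectrum (𝓞 ↥(maximalRealSubfield L)) in Filter.cofinite, ∀ i,
      Valued.v (algebraMap (↥(maximalRealSubfield L)) (v.adicCompletion ↥(maximalRealSubfield L))
        (⟨dV i, (IsCMField.complexConj_eq_self_iff (K := L) (dV i)).1 (hdV i)⟩ : ↥(maximalRealSubfield L))) = 1 := by
    simp only [Filter.eventually_all]
    exact fun i => eventually_valued_algebraMap_eq_one (↥(maximalRealSubfield L)) (hdV' i)
  filter_upwards [h_unr, h_twov, h_d, h_psi, h_dV] with v hunr h2v hdv hψ hdVv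
  intro ε 𝓢 χ₁ hsph
  obtain ⟨w⟩ := (inferInstance : Nonempty (PlacesOver L v))
  by_cases hw : IsCMField.complexConj L • w.1 = w.1
  · exact locF_eq_one_of_isSpherical_rep_of_smul_eq L e₁ dV hdV hdV0 ε 𝓢 v hunr h2v hdv hψ hdVv w hw χ₁ hsph
  · have hsq := QuadExt.isSquare_of_smul_ne (↥(maximalRealSubfield L)) L (IsCMField.complexConj L) (imagUnit_mul_self L) v w hw
    exact locF_eq_one_of_isSquare L hsq ε

end Summit.HodgeConjecture.HodgeConjecture.Cruxes.H413.F0P2gNSIAnySplitting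

end
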